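/-
Origin: expansion seat `planner-pub-hodgecm-pv14-g6-0`, handover none (imports Mathlib only) ; any order (independent leaf) (`HOME/pub-hodgecm-pv14-g6/lean/Pv14g6/SchwartzScalarProductRule.lean`, md5 82264cf0, 72 lines);
landed by the gen-8 packager in gate run 31 as `HodgeCM/Automorphic/SchwartzScalarProductRule.lean` (verbatim).
-/
/-
Copyright: HodgeCM public adjudication package, seat pub-hodgecm-pv14-g6 (DAG-NODE PROVER #14, gen 6).
File #19 of this seat.  Kernel-checked, no new axioms.  Imports Mathlib only.
-/
import Mathlib.Analysis.Distribution.SchwartzSpace.Basic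
import Mathlib.Analysis.Calculus.Deriv.Slope

/-!
# Scalar factors in difference quotients on Schwartz space

The genuine (metaplectic) Levi action carries the half-density character `|det a|^{1/2}`, and
modulation/character twists carry scalar factors `χ(s)`.  This file is the scalar product rule at the
level of difference quotients in `𝓢(E, F)`:

* `tendsto_smul_sub_div` : if `c : ℝ → 𝕜` (`𝕜 = ℝ` or `ℂ`) has `c 0 = 1`, `HasDerivAt c c' 0`, and a
  trajectory `w : ℝ → 𝓢(E, F)` has `t⁻¹ • (w t - Φ) → Y`, then `t⁻¹ • (c t • w t - Φ) → c' • Φ + Y`.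

Only published mathematics is used (Mathlib); nothing here refers to the objects under adjudication.
-/

noncomputable section

open Filter Topology
open scoped SchwartzMap

namespace HodgeCM
namespace SchwartzWeil

variable {E F : Type*} [NormedAddCommGroup E] [NormedSpace ℝ E] [NormedAddCommGroup F]
  [NormedSpace ℝ F]

/-- **Scalar product rule** for difference quotients in `𝓢(E, F)`. -/
theorem tendsto_smul_sub_div {𝕜 : Type*} [RCLike 𝕜] [NormedSpace 𝕜 F] [SMulCommClass ℝ 𝕜 F]
    [IsScalarTower ℝ 𝕜 F] {c : ℝ → 𝕜} {c' : 𝕜} (hc0 : c 0 = 1) (hc : HasDerivAt c c' 0)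
    {w : ℝ → 𝓢(E, F)} {Φ Y : 𝓢(E, F)}
    (hw : Tendsto (fun t : ℝ => t⁻¹ • (w t - Φ)) (𝓝[≠] 0) (𝓝 Y)) :
    Tendsto (fun t : ℝ => t⁻¹ • (c t • w t - Φ)) (𝓝[≠] 0) (𝓝 (c' • Φ + Y)) := by
  have h1 : Tendsto c (𝓝[≠] 0) (𝓝 1) := by
    have h := hc.continuousAt.tendsto
    rw [hc0] at h
    exact h.mono_left nhdsWithin_le_nhds
  have h2 : Tendsto (fun t : ℝ => t⁻¹ • (c t - 1)) (𝓝[≠] 0) (𝓝 c') := by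
    have h := hasDerivAt_iff_tendsto_slope_zero.mp hc
    simpa only [zero_add, hc0] using h
  have hA := h1.smul hw
  rw [one_smul] at hA
  have hB := h2.smul_const Φ
  have hsum := hB.add hA
  refine hsum.congr fun t => ?_
  show (t⁻¹ • (c t - 1)) • Φ + c t • (t⁻¹ • (w t - Φ)) = t⁻¹ • (c t • w t - Φ)
  rw [smul_assoc, ← smul_comm t⁻¹ (c t) (w t - Φ), ← smul_add]
  congr 1
  simp only [sub_smul, one_smul, smul_sub]
  abel

/-- The same with the scalar factor differentiated at a base point `s₀` with `c s₀ ≠ 0` is obtained by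
factoring `c (s₀ + t) = c s₀ • (c (s₀ + t) / c s₀)`; we record the special case most used:
a real character-like factor `c (s₀ + t) = c s₀ * c t`. -/
theorem tendsto_smul_sub_div_of_mul {𝕜 : Type*} [RCLike 𝕜] [NormedSpace 𝕜 F] [SMulCommClass ℝ 𝕜 F]
    [IsScalarTower ℝ 𝕜 F] {c : ℝ → 𝕜} {c' : 𝕜} (hc0 : c 0 = 1) (hc : HasDerivAt c c' 0)
    (hmul : ∀ s t, c (s + t) = c s * c t)
    {w : ℝ → 𝓢(E, F)} {Φ Y : 𝓢(E, F)} (s₀ : ℝ)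
    (hw : Tendsto (fun t : ℝ => t⁻¹ • (w t - Φ)) (𝓝[≠] 0) (𝓝 Y)) :
    Tendsto (fun t : ℝ => t⁻¹ • (c (s₀ + t) • w t - c s₀ • Φ)) (𝓝[≠] 0)
      (𝓝 (c s₀ • (c' • Φ + Y))) := by
  have h := (tendsto_smul_sub_div (E := E) hc0 hc hw).const_smul (c s₀)
  refine h.congr fun t => ?_
  show c s₀ • (t⁻¹ • (c t • w t - Φ)) = t⁻¹ • (c (s₀ + t) • w t - c s₀ • Φ)
  rw [hmul, smul_comm (c s₀) t⁻¹, smul_sub, smul_smul]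

end SchwartzWeil
end HodgeCM
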